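import Summits.QuantumFields.GaugeBoot.Rows.GLYZc1D4RedCheck1
import Summits.QuantumFields.GaugeBoot.Rows.GLYZc1D4RedCheck2
import Summits.QuantumFields.GaugeBoot.Rows.GLYZc1D4RedCheck3
import Summits.QuantumFields.GaugeBoot.Rows.GLYZc1D4RedCheck4
import Summits.QuantumFields.GaugeBoot.Rows.GLYZc1D4RedCheck5
import Summits.QuantumFields.GaugeBoot.Rows.GLYZc1D4RedCheck6
import Summits.QuantumFields.GaugeBoot.Rows.GLYZc1D4RedCheck7
import Summits.QuantumFields.GaugeBoot.Rows.GLYZc1D4RedCheck8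
import Summits.QuantumFields.GaugeBoot.Rows.GLYZc1D4RedCheck9
import Summits.QuantumFields.GaugeBoot.Rows.GLYZc1D4RedCheck10
import Summits.QuantumFields.GaugeBoot.Rows.GLYZc1D4RedCheck11
import Summits.QuantumFields.GaugeBoot.Rows.GLYZc1D4RedCheck12
import Summits.QuantumFields.GaugeBoot.Rows.GLYZc1D4Canon
import HarnessLib

/-!
# Gauge-boot: THE REDUCTION STEP — the 34 reduced positivity blocks of the glyz-c1-rp-4D problems are PSD for the torus state

Cell `pub-gaugeboot` (HOME `run/shared/lean/pub/pub-gaugeboot/`), seat lean1 (binding layer for rows C20–C31 = the certified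
glyz-c1-rp-4D windows, FANOUT-PLAN A126 (2): label sets, class/witness tables, the reduction identity, soundness, per-β bindings).

HONEST FRAMING (page 1 of every file of this cell): certified bounds on lattice expectations at STATED coupling,
gauge group, dimension and torus size; NOT a mass gap, NOT a continuum limit, NOT a string tension, NOT large `N`.
The venture is explicitly NOT Yang–Mills-summit-bearing (barriers `FixedCouplingUltralocality`,
`PerturbativeInvisibility`).

`redBlock k (y β L)` (`GLYZc1D4Ent`: block `k` of the problem files, entries `Σ c·y_v`, evaluated on the torus expectations
`y β L v = ⟨W_0(label v)⟩`) is positive semidefinite for every `k < 34`, every real `β ≥ 0` (`β ≥ 0` is used only by the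
link blocks `k ≥ 24`; `H` blocks need nothing, site blocks only `L` even), every even torus `(ℤ/L)⁴` with `L ≥ 4`:
`redBlock_posSemidef`. Proof = the kernel-checked identities `GLYZc1D4RedCheck1…` (file entries = `Y_kᵀ·cls·Y_k` as sparse
integer forms) + the evaluation lemmas below (`SVec.eval_expand`, `SVec.eval_eq_sum_fin`) giving
`redBlock k y = Y_kᴴ · rawBlock · Y_k` as real matrices + Mathlib's congruence `Matrix.PosSemidef.conjTranspose_mul_mul_same`
applied to the raw class-table blocks `rawBlockH/S/L_posSemidef` (`GLYZc1D4Canon`: Gram / site-RP / link-RP from the tree's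
`WordLoop` / `WordSiteRP` / `WordLinkRP`). With lean2's equality rows and lean3's certificate halves over `redBlock` this
closes rows C20–C31 end to end (per-β `GLYZc1D4BindB<β>`).
-/

noncomputable section

open Literature.MathematicalPhysics.QuantumFieldTheory
open Matrix

namespace Summit.QuantumFields.GaugeBoot

namespace GLYZc1D4

namespace SVec

/-- `eval` of a scaled, relabelled copy. -/
theorem eval_map_scale (g : ℕ → ℝ) (f : ℕ → ℕ) (c : ℤ) :
    ∀ l : SVec, eval g (l.map fun q => (f q.1, c * q.2)) = (c : ℝ) * eval (fun b => g (f b)) l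
  | [] => by simp
  | q :: t => by simp only [List.map_cons, eval_cons, eval_map_scale g f c t]; push_cast; ring

/-- **`eval` of an expansion is the iterated evaluation.** -/
theorem eval_expand (g : ℕ → ℝ) (cj : SVec) (cls : ℕ → ℕ → ℕ) :
    ∀ ci : SVec, eval g (expand ci cj cls) = eval (fun a => eval (fun b => g (cls a b)) cj) ci
  | [] => by simp [expand]
  | p :: t => by
    have ih := eval_expand g cj cls t
    simp only [expand, List.flatMap_cons] at ih ⊢
    rw [eval_append, ih, eval_map_scale, eval_cons]

/-- **A sparse form with keys `< n` evaluates as a finite sum over `Fin n` against its coefficients.** -/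
theorem eval_eq_sum_fin {n : ℕ} (g : ℕ → ℝ) : ∀ l : SVec, (∀ p ∈ l, p.1 < n) →
    eval g l = ∑ a : Fin n, (coeff l a.val : ℝ) * g a.val
  | [], _ => by simp [coeff]
  | (v, c) :: t, h => by
    have hv : v < n := h (v, c) List.mem_cons_self
    have ih := eval_eq_sum_fin g t fun p hp => h p (List.mem_cons_of_mem _ hp)
    have hsplit : ∀ a : Fin n, (coeff ((v, c) :: t) a.val : ℝ) * g a.val =
        (if a = ⟨v, hv⟩ then (c : ℝ) * g v else 0) + (coeff t a.val : ℝ) * g a.val := by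
      intro a
      by_cases ha : a = ⟨v, hv⟩
      · subst ha; simp [coeff, add_mul]
      · have hva : v ≠ a.val := fun h' => ha (Fin.ext h'.symm)
        simp [coeff, hva, ha]
    rw [Finset.sum_congr rfl fun a _ => hsplit a, Finset.sum_add_distrib, Finset.sum_ite_eq' Finset.univ, ← ih]
    simp

end SVec

variable (β : ℝ) (L : ℕ) [NeZero L]

/-- **Congruence step (generic in the block)**: if the sparse columns `cols` have raw indices `< n`, the normalised expansion of
`colsᵢᵀ·cls·colsⱼ` equals the entry table `entf` entry by entry, and the raw class-table matrix `(y (cls a b))_{a,b<n}` is PSD,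
then the `m × m` matrix of entry values `(eval y (entf i j))_{i,j}` is PSD — it is `Yᴴ · raw · Y`. -/
theorem entryMatrix_posSemidef {n m : ℕ} (y : Fin 1079 → ℝ) (cls : ℕ → ℕ → Fin 1079) (cols : ℕ → SVec)
    (entf : ℕ → ℕ → SVec) (hcols : ∀ i < m, ∀ p ∈ cols i, p.1 < n)
    (hid : ∀ i j : Fin m, SVec.dropZero (SVec.normExpand (cols i) (cols j) fun a b => (cls a b).val) = entf i j)
    (hraw : (Matrix.of fun a b : Fin n => y (cls a b)).PosSemidef) :
    (Matrix.of fun i j : Fin m => SVec.eval (yN y) (entf i.val j.val)).PosSemidef := by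
  set Y : Matrix (Fin n) (Fin m) ℝ := Matrix.of fun a i => (SVec.coeff (cols i.val) a.val : ℝ) with hY
  have key : (Matrix.of fun i j : Fin m => SVec.eval (yN y) (entf i.val j.val)) =
      Yᴴ * (Matrix.of fun a b : Fin n => y (cls a b)) * Y := by
    ext i j
    have h1 : SVec.eval (yN y) (entf i.val j.val) =
        SVec.eval (yN y) (SVec.expand (cols i.val) (cols j.val) fun a b => (cls a b).val) := by
      rw [← hid i j, SVec.eval_dropZero, SVec.eval_normExpand]
    rw [Matrix.of_apply, h1, SVec.eval_expand, SVec.eval_eq_sum_fin _ (cols i.val) (hcols i.val i.isLt)]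
    simp only [SVec.eval_eq_sum_fin _ (cols j.val) (hcols j.val j.isLt), Matrix.mul_apply, Matrix.conjTranspose_apply,
      Matrix.of_apply, star_trivial, hY, Finset.mul_sum, Finset.sum_mul]
    rw [Finset.sum_comm]
    refine Finset.sum_congr rfl fun b _ => Finset.sum_congr rfl fun a _ => ?_
    rw [show ((cls a.val b.val).val : ℕ) = (cls a b).val from rfl, yN_val]
    ring
  rw [key]
  exact hraw.conjTranspose_mul_mul_same Y

/-- **Reduced block 0** (`H/irrep0(d1,c+)`, 9 × 9) **is PSD for the torus state** (every torus, every real `β`). -/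
theorem redBlock_posSemidef_0 : (redBlock 0 (y β L)).PosSemidef :=
  entryMatrix_posSemidef (y β L) hcls (ycol 0) (ent 0) ycol_lt_0 red_ok_0 (rawBlockH_posSemidef β L)

/-- **Reduced block 1** (`H/irrep1(d1,c+)`, 3 × 3) **is PSD for the torus state** (every torus, every real `β`). -/
theorem redBlock_posSemidef_1 : (redBlock 1 (y β L)).PosSemidef :=
  entryMatrix_posSemidef (y β L) hcls (ycol 1) (ent 1) ycol_lt_1 red_ok_1 (rawBlockH_posSemidef β L)

/-- **Reduced block 2** (`H/irrep8(d2,c+)`, 11 × 11) **is PSD for the torus state** (every torus, every real `β`). -/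
theorem redBlock_posSemidef_2 : (redBlock 2 (y β L)).PosSemidef :=
  entryMatrix_posSemidef (y β L) hcls (ycol 2) (ent 2) ycol_lt_2 red_ok_2 (rawBlockH_posSemidef β L)

/-- **Reduced block 3** (`H/irrep12(d3,c+)`, 4 × 4) **is PSD for the torus state** (every torus, every real `β`). -/
theorem redBlock_posSemidef_3 : (redBlock 3 (y β L)).PosSemidef :=
  entryMatrix_posSemidef (y β L) hcls (ycol 3) (ent 3) ycol_lt_3 red_ok_3 (rawBlockH_posSemidef β L)

/-- **Reduced block 4** (`H/irrep13(d3,c+)`, 3 × 3) **is PSD for the torus state** (every torus, every real `β`). -/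
theorem redBlock_posSemidef_4 : (redBlock 4 (y β L)).PosSemidef :=
  entryMatrix_posSemidef (y β L) hcls (ycol 4) (ent 4) ycol_lt_4 red_ok_4 (rawBlockH_posSemidef β L)

/-- **Reduced block 5** (`H/irrep14(d3,c+)`, 10 × 10) **is PSD for the torus state** (every torus, every real `β`). -/
theorem redBlock_posSemidef_5 : (redBlock 5 (y β L)).PosSemidef :=
  entryMatrix_posSemidef (y β L) hcls (ycol 5) (ent 5) ycol_lt_5 red_ok_5 (rawBlockH_posSemidef β L)

/-- **Reduced block 6** (`H/irrep15(d3,c+)`, 7 × 7) **is PSD for the torus state** (every torus, every real `β`). -/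
theorem redBlock_posSemidef_6 : (redBlock 6 (y β L)).PosSemidef :=
  entryMatrix_posSemidef (y β L) hcls (ycol 6) (ent 6) ycol_lt_6 red_ok_6 (rawBlockH_posSemidef β L)

/-- **Reduced block 7** (`H/irrep4(d1,c-)`, 6 × 6) **is PSD for the torus state** (every torus, every real `β`). -/
theorem redBlock_posSemidef_7 : (redBlock 7 (y β L)).PosSemidef :=
  entryMatrix_posSemidef (y β L) hcls (ycol 7) (ent 7) ycol_lt_7 red_ok_7 (rawBlockH_posSemidef β L)

/-- **Reduced block 8** (`H/irrep5(d1,c-)`, 4 × 4) **is PSD for the torus state** (every torus, every real `β`). -/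
theorem redBlock_posSemidef_8 : (redBlock 8 (y β L)).PosSemidef :=
  entryMatrix_posSemidef (y β L) hcls (ycol 8) (ent 8) ycol_lt_8 red_ok_8 (rawBlockH_posSemidef β L)

/-- **Reduced block 9** (`H/irrep10(d2,c-)`, 10 × 10) **is PSD for the torus state** (every torus, every real `β`). -/
theorem redBlock_posSemidef_9 : (redBlock 9 (y β L)).PosSemidef :=
  entryMatrix_posSemidef (y β L) hcls (ycol 9) (ent 9) ycol_lt_9 red_ok_9 (rawBlockH_posSemidef β L)

/-- **Reduced block 10** (`H/irrep16(d3,c-)`, 3 × 3) **is PSD for the torus state** (every torus, every real `β`). -/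
theorem redBlock_posSemidef_10 : (redBlock 10 (y β L)).PosSemidef :=
  entryMatrix_posSemidef (y β L) hcls (ycol 10) (ent 10) ycol_lt_10 red_ok_10 (rawBlockH_posSemidef β L)

/-- **Reduced block 11** (`H/irrep17(d3,c-)`, 4 × 4) **is PSD for the torus state** (every torus, every real `β`). -/
theorem redBlock_posSemidef_11 : (redBlock 11 (y β L)).PosSemidef :=
  entryMatrix_posSemidef (y β L) hcls (ycol 11) (ent 11) ycol_lt_11 red_ok_11 (rawBlockH_posSemidef β L)

/-- **Reduced block 12** (`H/irrep18(d3,c-)`, 11 × 11) **is PSD for the torus state** (every torus, every real `β`). -/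
theorem redBlock_posSemidef_12 : (redBlock 12 (y β L)).PosSemidef :=
  entryMatrix_posSemidef (y β L) hcls (ycol 12) (ent 12) ycol_lt_12 red_ok_12 (rawBlockH_posSemidef β L)

/-- **Reduced block 13** (`H/irrep19(d3,c-)`, 7 × 7) **is PSD for the torus state** (every torus, every real `β`). -/
theorem redBlock_posSemidef_13 : (redBlock 13 (y β L)).PosSemidef :=
  entryMatrix_posSemidef (y β L) hcls (ycol 13) (ent 13) ycol_lt_13 red_ok_13 (rawBlockH_posSemidef β L)

/-- **Reduced block 14** (`site1/irrep0(d1,c+)`, 17 × 17) **is PSD for the torus state** (every even torus, every real `β`). -/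
theorem redBlock_posSemidef_14 (hL : Even L) : (redBlock 14 (y β L)).PosSemidef :=
  entryMatrix_posSemidef (y β L) scls (ycol 14) (ent 14) ycol_lt_14 red_ok_14 (rawBlockS_posSemidef β L hL)

/-- **Reduced block 15** (`site1/irrep1(d1,c+)`, 14 × 14) **is PSD for the torus state** (every even torus, every real `β`). -/
theorem redBlock_posSemidef_15 (hL : Even L) : (redBlock 15 (y β L)).PosSemidef :=
  entryMatrix_posSemidef (y β L) scls (ycol 15) (ent 15) ycol_lt_15 red_ok_15 (rawBlockS_posSemidef β L hL)

/-- **Reduced block 16** (`site1/irrep2(d1,c+)`, 4 × 4) **is PSD for the torus state** (every even torus, every real `β`). -/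
theorem redBlock_posSemidef_16 (hL : Even L) : (redBlock 16 (y β L)).PosSemidef :=
  entryMatrix_posSemidef (y β L) scls (ycol 16) (ent 16) ycol_lt_16 red_ok_16 (rawBlockS_posSemidef β L hL)

/-- **Reduced block 17** (`site1/irrep3(d1,c+)`, 3 × 3) **is PSD for the torus state** (every even torus, every real `β`). -/
theorem redBlock_posSemidef_17 (hL : Even L) : (redBlock 17 (y β L)).PosSemidef :=
  entryMatrix_posSemidef (y β L) scls (ycol 17) (ent 17) ycol_lt_17 red_ok_17 (rawBlockS_posSemidef β L hL)

/-- **Reduced block 18** (`site1/irrep8(d2,c+)`, 17 × 17) **is PSD for the torus state** (every even torus, every real `β`). -/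
theorem redBlock_posSemidef_18 (hL : Even L) : (redBlock 18 (y β L)).PosSemidef :=
  entryMatrix_posSemidef (y β L) scls (ycol 18) (ent 18) ycol_lt_18 red_ok_18 (rawBlockS_posSemidef β L hL)

/-- **Reduced block 19** (`site1/irrep4(d1,c-)`, 15 × 15) **is PSD for the torus state** (every even torus, every real `β`). -/
theorem redBlock_posSemidef_19 (hL : Even L) : (redBlock 19 (y β L)).PosSemidef :=
  entryMatrix_posSemidef (y β L) scls (ycol 19) (ent 19) ycol_lt_19 red_ok_19 (rawBlockS_posSemidef β L hL)

/-- **Reduced block 20** (`site1/irrep5(d1,c-)`, 14 × 14) **is PSD for the torus state** (every even torus, every real `β`). -/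
theorem redBlock_posSemidef_20 (hL : Even L) : (redBlock 20 (y β L)).PosSemidef :=
  entryMatrix_posSemidef (y β L) scls (ycol 20) (ent 20) ycol_lt_20 red_ok_20 (rawBlockS_posSemidef β L hL)

/-- **Reduced block 21** (`site1/irrep6(d1,c-)`, 3 × 3) **is PSD for the torus state** (every even torus, every real `β`). -/
theorem redBlock_posSemidef_21 (hL : Even L) : (redBlock 21 (y β L)).PosSemidef :=
  entryMatrix_posSemidef (y β L) scls (ycol 21) (ent 21) ycol_lt_21 red_ok_21 (rawBlockS_posSemidef β L hL)

/-- **Reduced block 22** (`site1/irrep7(d1,c-)`, 4 × 4) **is PSD for the torus state** (every even torus, every real `β`). -/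
theorem redBlock_posSemidef_22 (hL : Even L) : (redBlock 22 (y β L)).PosSemidef :=
  entryMatrix_posSemidef (y β L) scls (ycol 22) (ent 22) ycol_lt_22 red_ok_22 (rawBlockS_posSemidef β L hL)

/-- **Reduced block 23** (`site1/irrep9(d2,c-)`, 18 × 18) **is PSD for the torus state** (every even torus, every real `β`). -/
theorem redBlock_posSemidef_23 (hL : Even L) : (redBlock 23 (y β L)).PosSemidef :=
  entryMatrix_posSemidef (y β L) scls (ycol 23) (ent 23) ycol_lt_23 red_ok_23 (rawBlockS_posSemidef β L hL)

/-- **Reduced block 24** (`link1/irrep0(d1,c+)`, 17 × 17) **is PSD for the torus state** (every even torus `L ≥ 4`, `β ≥ 0`). -/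
theorem redBlock_posSemidef_24 (hL : Even L) (h4 : 4 ≤ L) (hβ : 0 ≤ β) : (redBlock 24 (y β L)).PosSemidef :=
  entryMatrix_posSemidef (y β L) lcls (ycol 24) (ent 24) ycol_lt_24 red_ok_24 (rawBlockL_posSemidef β L hL h4 hβ)

/-- **Reduced block 25** (`link1/irrep1(d1,c+)`, 14 × 14) **is PSD for the torus state** (every even torus `L ≥ 4`, `β ≥ 0`). -/
theorem redBlock_posSemidef_25 (hL : Even L) (h4 : 4 ≤ L) (hβ : 0 ≤ β) : (redBlock 25 (y β L)).PosSemidef :=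
  entryMatrix_posSemidef (y β L) lcls (ycol 25) (ent 25) ycol_lt_25 red_ok_25 (rawBlockL_posSemidef β L hL h4 hβ)

/-- **Reduced block 26** (`link1/irrep2(d1,c+)`, 4 × 4) **is PSD for the torus state** (every even torus `L ≥ 4`, `β ≥ 0`). -/
theorem redBlock_posSemidef_26 (hL : Even L) (h4 : 4 ≤ L) (hβ : 0 ≤ β) : (redBlock 26 (y β L)).PosSemidef :=
  entryMatrix_posSemidef (y β L) lcls (ycol 26) (ent 26) ycol_lt_26 red_ok_26 (rawBlockL_posSemidef β L hL h4 hβ)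

/-- **Reduced block 27** (`link1/irrep3(d1,c+)`, 3 × 3) **is PSD for the torus state** (every even torus `L ≥ 4`, `β ≥ 0`). -/
theorem redBlock_posSemidef_27 (hL : Even L) (h4 : 4 ≤ L) (hβ : 0 ≤ β) : (redBlock 27 (y β L)).PosSemidef :=
  entryMatrix_posSemidef (y β L) lcls (ycol 27) (ent 27) ycol_lt_27 red_ok_27 (rawBlockL_posSemidef β L hL h4 hβ)

/-- **Reduced block 28** (`link1/irrep8(d2,c+)`, 17 × 17) **is PSD for the torus state** (every even torus `L ≥ 4`, `β ≥ 0`). -/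
theorem redBlock_posSemidef_28 (hL : Even L) (h4 : 4 ≤ L) (hβ : 0 ≤ β) : (redBlock 28 (y β L)).PosSemidef :=
  entryMatrix_posSemidef (y β L) lcls (ycol 28) (ent 28) ycol_lt_28 red_ok_28 (rawBlockL_posSemidef β L hL h4 hβ)

/-- **Reduced block 29** (`link1/irrep4(d1,c-)`, 15 × 15) **is PSD for the torus state** (every even torus `L ≥ 4`, `β ≥ 0`). -/
theorem redBlock_posSemidef_29 (hL : Even L) (h4 : 4 ≤ L) (hβ : 0 ≤ β) : (redBlock 29 (y β L)).PosSemidef :=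
  entryMatrix_posSemidef (y β L) lcls (ycol 29) (ent 29) ycol_lt_29 red_ok_29 (rawBlockL_posSemidef β L hL h4 hβ)

/-- **Reduced block 30** (`link1/irrep5(d1,c-)`, 14 × 14) **is PSD for the torus state** (every even torus `L ≥ 4`, `β ≥ 0`). -/
theorem redBlock_posSemidef_30 (hL : Even L) (h4 : 4 ≤ L) (hβ : 0 ≤ β) : (redBlock 30 (y β L)).PosSemidef :=
  entryMatrix_posSemidef (y β L) lcls (ycol 30) (ent 30) ycol_lt_30 red_ok_30 (rawBlockL_posSemidef β L hL h4 hβ)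

/-- **Reduced block 31** (`link1/irrep6(d1,c-)`, 3 × 3) **is PSD for the torus state** (every even torus `L ≥ 4`, `β ≥ 0`). -/
theorem redBlock_posSemidef_31 (hL : Even L) (h4 : 4 ≤ L) (hβ : 0 ≤ β) : (redBlock 31 (y β L)).PosSemidef :=
  entryMatrix_posSemidef (y β L) lcls (ycol 31) (ent 31) ycol_lt_31 red_ok_31 (rawBlockL_posSemidef β L hL h4 hβ)

/-- **Reduced block 32** (`link1/irrep7(d1,c-)`, 4 × 4) **is PSD for the torus state** (every even torus `L ≥ 4`, `β ≥ 0`). -/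
theorem redBlock_posSemidef_32 (hL : Even L) (h4 : 4 ≤ L) (hβ : 0 ≤ β) : (redBlock 32 (y β L)).PosSemidef :=
  entryMatrix_posSemidef (y β L) lcls (ycol 32) (ent 32) ycol_lt_32 red_ok_32 (rawBlockL_posSemidef β L hL h4 hβ)

/-- **Reduced block 33** (`link1/irrep9(d2,c-)`, 18 × 18) **is PSD for the torus state** (every even torus `L ≥ 4`, `β ≥ 0`). -/
theorem redBlock_posSemidef_33 (hL : Even L) (h4 : 4 ≤ L) (hβ : 0 ≤ β) : (redBlock 33 (y β L)).PosSemidef :=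
  entryMatrix_posSemidef (y β L) lcls (ycol 33) (ent 33) ycol_lt_33 red_ok_33 (rawBlockL_posSemidef β L hL h4 hβ)

/-- **THE REDUCTION STEP**: for `SU(2)` lattice gauge theory on every even torus `(ℤ/L)⁴` with `L ≥ 4` and every standard
coupling `β ≥ 0`, all 34 reduced positivity blocks of the certified glyz-c1-rp-4D problems, evaluated on the torus loop
expectations `y β L`, are positive semidefinite. -/
theorem redBlock_posSemidef (hβ : 0 ≤ β) (hL : Even L) (h4 : 4 ≤ L) : ∀ k : Fin 34, (redBlock k (y β L)).PosSemidef := by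
  intro k
  fin_cases k
  exacts [redBlock_posSemidef_0 β L,
    redBlock_posSemidef_1 β L,
    redBlock_posSemidef_2 β L,
    redBlock_posSemidef_3 β L,
    redBlock_posSemidef_4 β L,
    redBlock_posSemidef_5 β L,
    redBlock_posSemidef_6 β L,
    redBlock_posSemidef_7 β L,
    redBlock_posSemidef_8 β L,
    redBlock_posSemidef_9 β L,
    redBlock_posSemidef_10 β L,
    redBlock_posSemidef_11 β L,
    redBlock_posSemidef_12 β L,
    redBlock_posSemidef_13 β L,
    redBlock_posSemidef_14 β L hL,
    redBlock_posSemidef_15 β L hL,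
    redBlock_posSemidef_16 β L hL,
    redBlock_posSemidef_17 β L hL,
    redBlock_posSemidef_18 β L hL,
    redBlock_posSemidef_19 β L hL,
    redBlock_posSemidef_20 β L hL,
    redBlock_posSemidef_21 β L hL,
    redBlock_posSemidef_22 β L hL,
    redBlock_posSemidef_23 β L hL,
    redBlock_posSemidef_24 β L hL h4 hβ,
    redBlock_posSemidef_25 β L hL h4 hβ,
    redBlock_posSemidef_26 β L hL h4 hβ,
    redBlock_posSemidef_27 β L hL h4 hβ,
    redBlock_posSemidef_28 β L hL h4 hβ,
    redBlock_posSemidef_29 β L hL h4 hβ,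
    redBlock_posSemidef_30 β L hL h4 hβ,
    redBlock_posSemidef_31 β L hL h4 hβ,
    redBlock_posSemidef_32 β L hL h4 hβ,
    redBlock_posSemidef_33 β L hL h4 hβ]

end GLYZc1D4

end Summit.QuantumFields.GaugeBoot

end
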